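import Literature.Analysis.FluidPDE.MildL3SmoothAssembly
import Literature.Analysis.FluidPDE.NSBoundedMildAnalytic
import HarnessLib

/-!
# `mild_L3_smooth` from the local analyticity of Oseen's scheme (Lemarié-Rieusset 2016, Thm. 9.12)

Analysis/FluidPDE assembly file (proofs only, no definitions, no named facts) recording a **second
discharge path** for the named fact `Literature.Analysis.FluidPDE.mild_L3_smooth`
(`NSLerayHopfSereginProofs.lean`; Giga 1986, Thm. 4 and the Remark following it, p. 202; mild
solutions in `C([0,T); L³(ℝ³))` are classical for positive times). `MildL3SmoothAssembly.lean`
reduced the fact to the KNSS local smoothing theory (L) `knss2009_local_smoothing ℝ³`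
(`mild_L3_smooth_of_local`); the sibling local fact of the tree,
`lemarieRieusset2016_local_analyticity` (`NSBoundedMildAnalytic.lean`: the fixed point of Oseen's
`L^∞` scheme from a bounded datum is jointly real-analytic on its window of existence;
Lemarié-Rieusset 2016, Thm. 9.12, PDF pp. 260–263, after Cannon–Knightly), serves equally well:
`NSBoundedMildAnalytic.lean` proves `classical_of_bounded_mild_L3_of_local_analyticity`, and the
other two inputs of `mild_L3_smooth_of_facts` (`MildL3Smooth.lean`) are discharged in the tree
(`mild_L3_restart_holds`, `MildL3RestartAveraging.lean`; `kato_local_L3_holds`,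
`KatoLocalL3Exists.lean`). Hence

* `mild_L3_smooth_of_local_analyticity : lemarieRieusset2016_local_analyticity → mild_L3_smooth`,
* `seregin_L3_blowup_of_mild_local_analyticity` (Seregin's `L³` criterion in the tree's form from
  Lemarié-Rieusset's Thm. 15.5 `seregin_L3_blowup_mild` and the local analyticity fact),

so that `mild_L3_smooth` closes as soon as either local fact — (L) or the analytic one — is
discharged.

## Mathlib / tree search

Tree (`lean search 'mild_L3_smooth_of|of_local_analyticity'`): `mild_L3_smooth_of_facts`
(`MildL3Smooth`), `mild_L3_smooth_of_smoothing`, `mild_L3_smooth_of_local`,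
`seregin_L3_blowup_of_mild_local` (`MildL3SmoothAssembly`), `seregin_L3_blowup_of_facts`
(`MildL3Smooth`), `classical_of_bounded_mild_L3_of_local_analyticity`,
`analytic_of_bounded_mild_L3_of_local_analyticity` (`NSBoundedMildAnalytic`); no assembly of
`mild_L3_smooth` from the analytic local fact existed. Mathlib: none (no Navier–Stokes theory).

## References

* Y. Giga, *Solutions for semilinear parabolic equations in `Lᵖ` and regularity of weak
  solutions of the Navier–Stokes system*, J. Differential Equations 62 (1986) 186–212, Thm. 4
  and the Remark following it (p. 202). [Giga1986]
* P. G. Lemarié-Rieusset, *The Navier–Stokes Problem in the 21st Century*, CRC Press 2016,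
  doi:10.1201/b19556, Thm. 9.12 (PDF pp. 260–263), proof of Thm. 15.1 (A) (PDF p. 565),
  Thm. 15.5. [LemarieRieusset2016]
* G. Seregin, Comm. Math. Phys. 312 (2012) 833–845, Thm. 1.1. [Seregin2012CMP]
-/

noncomputable section

namespace Literature.Analysis.FluidPDE

/-- **`mild_L3_smooth` from the local analyticity of Oseen's scheme** (Lemarié-Rieusset 2016,
Thm. 9.12; Giga 1986, Thm. 4 and Remark p. 202: the mild `C([0,T₀); L³)` solution is a
classical smooth solution on `(0, T₀)`): `mild_L3_smooth_of_facts` fed with the discharged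
`mild_L3_restart_holds`, `kato_local_L3_holds` and the tree's reduction
`classical_of_bounded_mild_L3_of_local_analyticity`. [cite: Giga1986, Thm. 4, Remark (p. 202)] [cite: LemarieRieusset2016, Thm. 9.12 (PDF p. 260)] -/
theorem mild_L3_smooth_of_local_analyticity (hA : lemarieRieusset2016_local_analyticity) :
    mild_L3_smooth :=
  mild_L3_smooth_of_facts mild_L3_restart_holds kato_local_L3_holds
    (classical_of_bounded_mild_L3_of_local_analyticity hA)

/-- **Seregin's `L³` criterion re-routed to the local analyticity fact**: the tree's form
`seregin_L3_blowup` from Lemarié-Rieusset's Thm. 15.5 (`seregin_L3_blowup_mild`) and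
`lemarieRieusset2016_local_analyticity`, through `seregin_L3_blowup_of_facts`.
[cite: LemarieRieusset2016, Thm. 15.5] [cite: Seregin2012CMP, Thm. 1.1] -/
theorem seregin_L3_blowup_of_mild_local_analyticity (h15 : seregin_L3_blowup_mild)
    (hA : lemarieRieusset2016_local_analyticity) : seregin_L3_blowup :=
  seregin_L3_blowup_of_facts h15 (mild_L3_smooth_of_local_analyticity hA)

end Literature.Analysis.FluidPDE

end
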